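import Mathlib.LinearAlgebra.CrossProduct
import Mathlib.LinearAlgebra.Matrix.DotProduct
import Mathlib.Topology.MetricSpace.HausdorffDimension
import Mathlib.Analysis.Calculus.ContDiff.RCLike
import Mathlib.Analysis.SpecialFunctions.Sqrt
import Mathlib.Analysis.SpecialFunctions.Pow.Deriv
import HarnessLib

/-!
# Smooth orthonormal framings of a nowhere-vanishing `C¹` family of vectors in `ℝ³`

Topic `Analysis/Calculus`; namespace `Literature.Analysis.Calculus`.  Theorems only; no named
fact, no `sorry`.  For a `C¹` map `u : ℝ → ℝ³` with `u θ ≠ 0` for all `θ` (e.g. a periodic one,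
a loop of directions):

* `exists_forall_crossProduct_ne_zero` — **a direction transverse to the whole family**: there is
  `c ∈ ℝ³` with `c × u(θ) ≠ 0` for every `θ`.  ("Sard-lite": the cone `{t u(θ)}` is the image of
  `ℝ²` under a `C¹`, hence locally Lipschitz, map, so has Hausdorff dimension `≤ 2 < 3`
  (`dimH_range_le_of_locally_lipschitzOn`, `Real.dimH_univ_eq_finrank`), and any `c` outside it
  works.)
* `exists_contDiff_orthonormal_frame` — **a smooth orthonormal, positively oriented frame
  `(f₀, f₁, f₂)` of `ℝ³` with `f₂ = u/|u|`**, depending smoothly on `θ` when `u` is `C^∞`, and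
  `T`-periodic whenever `u` is: `f₀ = c × u /|c × u|`, `f₁ = f₂ × f₀`.

This frames the normal plane field `u(θ)^⊥` along a loop without parallel transport; it is the
framing step of the adapted tube chart about an even zero circle of a near-symplectic form
(`Literature/Geometry/Symplectic`, Perutz 2006 §3: orthonormal frame `(e₁, e₂, e₃)` of the normal
bundle with `e₃` spanning the negative eigenline).  Vectors are `Fin 3 → ℝ` with Mathlib's
`dotProduct`/`crossProduct`; lengths are `√(v ⬝ᵥ v)`.

## References

* M. W. Hirsch, *Differential Topology*, GTM 33 (1976), Ch. 3, Thm. 1.3 (images of lower-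
  dimensional manifolds have measure zero). [HirschDT1976]
* T. Perutz, *Zero-sets of near-symplectic forms*, J. Symplectic Geom. 4 (2006), §3. [Perutz2006]
-/

noncomputable section

open Set Function Module
open scoped Matrix ENNReal ContDiff

namespace Literature.Analysis.Calculus

/-! ### Vectors parallel to a non-zero vector -/

/-- `c × v = 0` with `v ≠ 0` forces `c ∈ ℝ v`. [folklore] -/
theorem exists_smul_eq_of_crossProduct_eq_zero {c v : Fin 3 → ℝ} (h : c ⨯₃ v = 0) (hv : v ≠ 0) :
    ∃ t : ℝ, t • v = c := by
  have h' : v ⨯₃ c = 0 := by rw [← cross_anticomm, h, neg_zero]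
  have hli : ¬ LinearIndependent ℝ ![v, c] := fun hl ↦
    (crossProduct_ne_zero_iff_linearIndependent.2 hl) h'
  rw [LinearIndependent.pair_iff' hv] at hli
  push Not at hli
  exact hli

/-! ### A direction transverse to a `C¹` family -/

/-- **Sard-lite: a fixed direction transverse to a nowhere-zero `C¹` family in `ℝ³`.**  If
`u : ℝ → ℝ³` is `C¹` with `u θ ≠ 0` for all `θ`, there is `c` with `c × u θ ≠ 0` for all `θ`
(the cone `⋃_θ ℝ u(θ)`, image of `ℝ²` under the locally Lipschitz map `(t, θ) ↦ t u(θ)`, has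
Hausdorff dimension at most `2`, so it is not all of `ℝ³`). [cite: HirschDT1976, Ch. 3 Thm. 1.3] -/
theorem exists_forall_crossProduct_ne_zero {u : ℝ → Fin 3 → ℝ} (hu : ContDiff ℝ 1 u)
    (h0 : ∀ θ, u θ ≠ 0) : ∃ c : Fin 3 → ℝ, ∀ θ, c ⨯₃ u θ ≠ 0 := by
  by_contra hcon
  push Not at hcon
  set f : ℝ × ℝ → Fin 3 → ℝ := fun p ↦ p.1 • u p.2 with hf
  have hfs : ContDiff ℝ 1 f := contDiff_fst.smul (hu.comp contDiff_snd)
  have hrange : range f = univ := by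
    refine eq_univ_of_forall fun c ↦ ?_
    obtain ⟨θ, hθ⟩ := hcon c
    obtain ⟨t, ht⟩ := exists_smul_eq_of_crossProduct_eq_zero hθ (h0 θ)
    exact ⟨(t, θ), ht⟩
  have hdim : dimH (range f) ≤ dimH (univ : Set (ℝ × ℝ)) :=
    dimH_range_le_of_locally_lipschitzOn fun x ↦ hfs.contDiffAt.exists_lipschitzOnWith
  rw [hrange, Real.dimH_univ_eq_finrank, Real.dimH_univ_eq_finrank, finrank_prod, finrank_self,
    finrank_fintype_fun_eq_card, Fintype.card_fin] at hdim
  have h32 : ¬ ((3 : ℕ) : ℝ≥0∞) ≤ ((1 + 1 : ℕ) : ℝ≥0∞) := by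
    rw [Nat.cast_le]; norm_num
  exact h32 hdim

/-! ### Euclidean lengths on `Fin 3 → ℝ` through the dot product -/

/-- The normalisation `|v|⁻¹ v` has unit length: `(|v|⁻¹ v) ⬝ᵥ (|v|⁻¹ v) = 1`
(`0 < v ⬝ᵥ v` for `v ≠ 0` is the tree's `GS3.dotProduct_self_pos'`, re-derived inline to keep
this file's imports light). [folklore] -/
theorem dotProduct_normalize_self {v : Fin 3 → ℝ} (hv : v ≠ 0) :
    ((Real.sqrt (v ⬝ᵥ v))⁻¹ • v) ⬝ᵥ ((Real.sqrt (v ⬝ᵥ v))⁻¹ • v) = 1 := by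
  have hnn : 0 ≤ v ⬝ᵥ v := Finset.sum_nonneg fun i _ ↦ mul_self_nonneg (v i)
  have hp : 0 < v ⬝ᵥ v :=
    lt_of_le_of_ne hnn fun h ↦ hv (dotProduct_self_eq_zero.1 h.symm)
  rw [smul_dotProduct, dotProduct_smul, smul_eq_mul, smul_eq_mul, ← mul_assoc,
    ← mul_inv, ← Real.sqrt_mul hnn, Real.sqrt_mul_self hnn, inv_mul_cancel₀ hp.ne']

/-! ### Smoothness of dot products and normalisations of smooth families -/

/-- Dot products of `C^n` families are `C^n`. [folklore] -/
theorem contDiff_dotProduct {n : WithTop ℕ∞} {a b : ℝ → Fin 3 → ℝ} (ha : ContDiff ℝ n a)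
    (hb : ContDiff ℝ n b) : ContDiff ℝ n fun θ ↦ a θ ⬝ᵥ b θ :=
  ContDiff.sum fun i _ ↦ (contDiff_pi.1 ha i).mul (contDiff_pi.1 hb i)

/-- Normalisations of nowhere-zero `C^n` families are `C^n`. [folklore] -/
theorem contDiff_normalize {n : WithTop ℕ∞} {a : ℝ → Fin 3 → ℝ} (ha : ContDiff ℝ n a)
    (h0 : ∀ θ, a θ ≠ 0) : ContDiff ℝ n fun θ ↦ (Real.sqrt (a θ ⬝ᵥ a θ))⁻¹ • a θ := by
  have hp : ∀ θ, 0 < a θ ⬝ᵥ a θ := fun θ ↦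
    lt_of_le_of_ne (Finset.sum_nonneg fun i _ ↦ mul_self_nonneg (a θ i))
      fun h ↦ h0 θ (dotProduct_self_eq_zero.1 h.symm)
  have h1 : ContDiff ℝ n fun θ ↦ Real.sqrt (a θ ⬝ᵥ a θ) :=
    (contDiff_dotProduct ha ha).sqrt fun θ ↦ (hp θ).ne'
  have h2 : ContDiff ℝ n fun θ ↦ (Real.sqrt (a θ ⬝ᵥ a θ))⁻¹ :=
    h1.inv fun θ ↦ (Real.sqrt_pos.2 (hp θ)).ne'
  exact h2.smul ha

/-! ### The orthonormal frame -/

/-- **Smooth positively oriented orthonormal framing with prescribed last vector.**  For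
`u : ℝ → ℝ³` of class `C^∞` with `u θ ≠ 0` for all `θ`, there is a frame `f 0, f 1, f 2 : ℝ → ℝ³`,
each `C^∞`, with `f i θ ⬝ᵥ f j θ = δ_{ij}`, `f 2 θ = u θ / |u θ|`, `f 0 θ × f 1 θ = f 2 θ`
(positive orientation), and `T`-periodic in `θ` for every period `T` of `u`.  Construction:
`f 0 = c × u / |c × u|` for a direction `c` transverse to the family
(`exists_forall_crossProduct_ne_zero`), `f 1 = f 2 × f 0`. [cite: Perutz2006, §3] -/
theorem exists_contDiff_orthonormal_frame {u : ℝ → Fin 3 → ℝ} (hu : ContDiff ℝ ∞ u)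
    (h0 : ∀ θ, u θ ≠ 0) :
    ∃ f : Fin 3 → ℝ → Fin 3 → ℝ, (∀ i, ContDiff ℝ ∞ (f i)) ∧
      (∀ θ (i j : Fin 3), f i θ ⬝ᵥ f j θ = if i = j then 1 else 0) ∧
      (∀ θ, f 2 θ = (Real.sqrt (u θ ⬝ᵥ u θ))⁻¹ • u θ) ∧
      (∀ θ, f 0 θ ⨯₃ f 1 θ = f 2 θ) ∧
      ∀ T : ℝ, (∀ θ, u (θ + T) = u θ) → ∀ i θ, f i (θ + T) = f i θ := by
  obtain ⟨c, hc⟩ := exists_forall_crossProduct_ne_zero (hu.of_le (by exact_mod_cast le_top)) h0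
  -- cross products of smooth families are smooth (the tree's
  -- `Literature.Topology.FourManifolds.contDiff_cross`, re-derived here to keep imports light)
  have hcross : ∀ {a b : ℝ → Fin 3 → ℝ}, ContDiff ℝ ∞ a → ContDiff ℝ ∞ b →
      ContDiff ℝ ∞ fun θ ↦ a θ ⨯₃ b θ := by
    intro a b ha hb
    have h : ∀ i, ContDiff ℝ ∞ fun θ ↦ a θ i := fun i ↦ contDiff_pi.1 ha i
    have h' : ∀ i, ContDiff ℝ ∞ fun θ ↦ b θ i := fun i ↦ contDiff_pi.1 hb i
    refine contDiff_pi.2 fun i ↦ ?_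
    fin_cases i
    · simp only [cross_apply, Fin.zero_eta, Matrix.cons_val_zero]
      exact ((h 1).mul (h' 2)).sub ((h 2).mul (h' 1))
    · simp only [cross_apply, Fin.mk_one, Matrix.cons_val_one, Matrix.cons_val_zero]
      exact ((h 2).mul (h' 0)).sub ((h 0).mul (h' 2))
    · simp only [cross_apply, Fin.reduceFinMk, Matrix.cons_val]
      exact ((h 0).mul (h' 1)).sub ((h 1).mul (h' 0))
  -- the three fields
  set g : ℝ → Fin 3 → ℝ := fun θ ↦ c ⨯₃ u θ with hg
  set f0 : ℝ → Fin 3 → ℝ := fun θ ↦ (Real.sqrt (g θ ⬝ᵥ g θ))⁻¹ • g θ with hf0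
  set f2 : ℝ → Fin 3 → ℝ := fun θ ↦ (Real.sqrt (u θ ⬝ᵥ u θ))⁻¹ • u θ with hf2
  set f1 : ℝ → Fin 3 → ℝ := fun θ ↦ f2 θ ⨯₃ f0 θ with hf1
  -- smoothness
  have hgs : ContDiff ℝ ∞ g := hcross (contDiff_const (c := c)) hu
  have hf0s : ContDiff ℝ ∞ f0 := contDiff_normalize hgs hc
  have hf2s : ContDiff ℝ ∞ f2 := contDiff_normalize hu h0
  have hf1s : ContDiff ℝ ∞ f1 := hcross hf2s hf0s
  -- pointwise orthonormality
  have h00 : ∀ θ, f0 θ ⬝ᵥ f0 θ = 1 := fun θ ↦ dotProduct_normalize_self (hc θ)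
  have h22 : ∀ θ, f2 θ ⬝ᵥ f2 θ = 1 := fun θ ↦ dotProduct_normalize_self (h0 θ)
  have h02 : ∀ θ, f0 θ ⬝ᵥ f2 θ = 0 := fun θ ↦ by
    have h1 : g θ ⬝ᵥ u θ = 0 := by
      show (c ⨯₃ u θ) ⬝ᵥ u θ = 0
      rw [dotProduct_comm]; exact dot_cross_self _ _
    simp only [hf0, hf2, smul_dotProduct, dotProduct_smul, smul_eq_mul, h1, mul_zero]
  have h20 : ∀ θ, f2 θ ⬝ᵥ f0 θ = 0 := fun θ ↦ by rw [dotProduct_comm, h02]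
  have h11 : ∀ θ, f1 θ ⬝ᵥ f1 θ = 1 := fun θ ↦ by
    simp only [hf1]
    rw [cross_dot_cross, h22, h00, h20, h02]; ring
  have h12 : ∀ θ, f1 θ ⬝ᵥ f2 θ = 0 := fun θ ↦ by
    simp only [hf1]; rw [dotProduct_comm, dot_self_cross]
  have h10 : ∀ θ, f1 θ ⬝ᵥ f0 θ = 0 := fun θ ↦ by
    simp only [hf1]; rw [dotProduct_comm, dot_cross_self]
  have h21 : ∀ θ, f2 θ ⬝ᵥ f1 θ = 0 := fun θ ↦ by rw [dotProduct_comm, h12]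
  have h01 : ∀ θ, f0 θ ⬝ᵥ f1 θ = 0 := fun θ ↦ by rw [dotProduct_comm, h10]
  -- orientation: `f0 × f1 = f0 × (f2 × f0) = (f0·f0) f2 - (f2·f0) f0 = f2`
  have hor : ∀ θ, f0 θ ⨯₃ f1 θ = f2 θ := fun θ ↦ by
    simp only [hf1]
    rw [cross_cross_eq_smul_sub_smul', h00, h20, one_smul, zero_smul, sub_zero]
  refine ⟨![f0, f1, f2], ?_, ?_, fun θ ↦ rfl, fun θ ↦ hor θ, ?_⟩
  · intro i
    fin_cases i
    · exact hf0s
    · exact hf1s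
    · exact hf2s
  · intro θ i j
    fin_cases i <;> fin_cases j
    · simpa using h00 θ
    · simpa using h01 θ
    · simpa using h02 θ
    · simpa using h10 θ
    · simpa using h11 θ
    · simpa using h12 θ
    · simpa using h20 θ
    · simpa using h21 θ
    · simpa using h22 θ
  · intro T hT i θ
    have hgT : g (θ + T) = g θ := by simp only [hg, hT]
    have hf0T : f0 (θ + T) = f0 θ := by simp only [hf0, hgT]
    have hf2T : f2 (θ + T) = f2 θ := by simp only [hf2, hT]
    have hf1T : f1 (θ + T) = f1 θ := by simp only [hf1, hf0T, hf2T]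
    fin_cases i
    · exact hf0T
    · exact hf1T
    · exact hf2T

end Literature.Analysis.Calculus

end
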